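import Summits.BirchSwinnertonDyer.BirchSwinnertonDyer.Theorems.ByReductionTypeAtTwoSupersingularTowerTorsionTwo
import Summits.BirchSwinnertonDyer.BirchSwinnertonDyer.Theorems.ThetaPartnerAtTwoSignedControlAtTwoLocalNonDivTwo
import HarnessLib

/-!
# (GEN₀) ⟺ `v`-adic non-divisibility — the last clause «`E(ℚ_v) ⊆ ℤd₀ + 2E(ℚ_v)`» of the plus Honda system at `2`
# (HONDA⁺@2, K4 `SignedControlAtTwo`, stmt-BirchSwinnertonDyer-20309, line `eulerchar`) is equivalent to «`d₀ ∉ 2E(ℚ_v)`»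

Route `ThetaPartnerAtTwo` (TP2; crux shared with RTT), crux K4, line `eulerchar` v5 (lead `prover-bsd-wall-tp2-p3` g2); seat
`prover-bsd-wall-tp2-p3-w3` (width seat 3/3). For the construction of HONDA⁺@2 (K3 lead `tp2-p2x`, points `e_n`, clause (GEN₀)).

WHAT. The one research statement left on line `eulerchar` is the plus Honda system HONDA⁺@2 (hypothesis `hHONDA` of
`SignedEC.stub_plusCyclicLayersTwo_of_honda` / `stub_plusLocKummerTwo_of_honda` / `stub_plusLocalInjTwo_of_honda`); its fourth clause
(GEN₀) asks that `d 0` generate `E(ℚ_v) = localLayerPointsOfEmb κ ι W 0` modulo `2`. This file shows that, for a globally minimal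
`W/ℚ` with `GoodSS W 2`, (GEN₀) is EQUIVALENT to the `v`-adic non-divisibility `∀ b ∈ E(ℚ_v), d 0 ≠ 2 • b`:
* §1 (any number field `K`, place `v`, `n ≠ 0`; Mathlib points of `W ⊗ K_v`) `index_range_nsmul_adicCompletion_eq_two`,
  `forall_exists_eq_zsmul_add_nsmul_adicCompletion`: if `E(K_v)[n] = 0` and `#(𝒪_v/n𝒪_v) = 2` then `[E(K_v) : nE(K_v)] = 2`
  (Milne, *ADT* I Lemma 3.3 = tree theorem `WeierstrassCurve.card_quotient_range_nsmul_adicCompletion`), so a subgroup of index `2`: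
  every point NOT in `nE(K_v)` generates `E(K_v)/nE(K_v)` (`AddSubgroup.add_mem_iff_of_index_two`): `P = a•P₀ + n•R`, `a ∈ {0, −1}`.
* §2 (transport to the tree's local points, any `ℤ_p`-extension `κ`, any embedding `ι`) the `Γ_{K_v}`-fixed points of `E(K̄_v)` are
  the points of `E(K_v)` (`toGeomPoints`, Galois descent `exists_toGeomPoints_eq_of_forall_smul_eq` along `localPointsEquivBaseChange`,
  exactly as in `…LocalNonDivTwo`): `forall_exists_eq_zsmul_add_nsmul_localLayerPointsOfEmb_zero`.
* §3 (`K = ℚ`, `n = 2`, `v ∋ 2`, glob-min `W` with `GoodSS W 2`): `E(ℚ_v)[2] = 0` is the tree theorem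
  `SSFlatEC.two_nsmul_eq_zero_padic_of_goodSS_two` (+ `forall_nsmul_eq_zero_adicCompletion_iff_padic`), `#(ℤ_v/2) = 2` is
  `natCard_adicCompletionIntegers_quot_span_prime`; hence **`plusGenZero_two_of_ne_two_nsmul`**: (GEN₀) ⟸ `d₀ ∉ 2E(ℚ_v)`; and
  conversely **`ne_two_nsmul_of_plusGenZero`**: (GEN₀) ⟹ `d₀ ∉ 2E(ℚ_v)` for EVERY elliptic `W/ℚ` (by LEV0@2,
  `exists_mem_localLayerPointsOfEmb_zero_ne_two_nsmul`, p585289).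
* §4 the package glue: HONDA⁺@2 with its fourth clause replaced by «`∀ b ∈ E(ℚ_v), d 0 ≠ 2 • b`» implies HONDA⁺@2 verbatim, per
  curve-and-place (`hondaSystem_two_of_nonDiv`) and over the sub-row (`plusHondaSystemTwo_of_nonDiv`, conclusion = `hHONDA` verbatim).

HONEST FRAMING: THEOREMS ONLY (no definition, no named fact, no `sorry`), route-independent (no `Theses` import); closes nothing by
itself — it shrinks the (GEN₀) clause of the one research stub HONDA⁺@2 to a valuation-type statement about the single point `d 0`;
BSD is not proved by any of this.

References: [MilneADT2006] J. S. Milne, *Arithmetic Duality Theorems*, 2nd ed., I Lemma 3.3; [SilvermanAEC2009] J. H. Silverman,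
*The Arithmetic of Elliptic Curves*, 2nd ed., Prop. VII.6.3, VIII.§1; [Kobayashi2003] S. Kobayashi, Invent. Math. 152 (2003), §8.4
(Lemma 8.9, Prop. 8.11: the generator `c₀` of `Ê(pℤ_p)`); [Sprung2012] F. Sprung, J. Number Theory 132 (2012), Lemma 2.3.
-/

set_option autoImplicit false
-- the Theorems namespace of this sub repeats the summit name by design (D-0017 nested layout)
set_option linter.dupNamespace false

noncomputable section

open scoped Classical NumberField

open NumberField IsDedekindDomain WeierstrassCurve Literature.NumberTheory.EllipticCurves
  Literature.NumberTheory.EllipticCurves.Kobayashi2003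

universe u

namespace Summit.BirchSwinnertonDyer.BirchSwinnertonDyer.Theorems.SignedEC

/-! ## §1 Index `2`: every non-multiple generates `E(K_v)/nE(K_v)` (Milne I Lemma 3.3) -/

section General

variable {K : Type u} [Field K] [NumberField K] (W : WeierstrassCurve K) [W.IsElliptic]
  (v : HeightOneSpectrum (𝓞 K))

/-- **`[E(K_v) : nE(K_v)] = 2` when `E(K_v)[n] = 0` and `#(𝒪_v/n𝒪_v) = 2`** (Milne I Lemma 3.3:
`#E(K_v)/nE(K_v) = #E(K_v)[n] · #(𝒪_v/n𝒪_v)`). [cite: MilneADT2006, I Lemma 3.3] [cite: SilvermanAEC2009, Prop. VII.6.3] -/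
theorem index_range_nsmul_adicCompletion_eq_two {n : ℕ} (hn : n ≠ 0)
    (hker : ∀ Q : (W.baseChange (v.adicCompletion K)).toAffine.Point, n • Q = 0 → Q = 0)
    (hO : Nat.card (v.adicCompletionIntegers K ⧸ Ideal.span {(n : v.adicCompletionIntegers K)}) = 2) :
    (nsmulAddMonoidHom n : (W.baseChange (v.adicCompletion K)).toAffine.Point →+ _).range.index = 2 := by
  have hbot : (nsmulAddMonoidHom n : (W.baseChange (v.adicCompletion K)).toAffine.Point →+ _).ker = ⊥ := by
    rw [AddSubgroup.eq_bot_iff_forall]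
    intro Q hQ
    exact hker Q (by rwa [AddMonoidHom.mem_ker, nsmulAddMonoidHom_apply] at hQ)
  have hcard := W.card_quotient_range_nsmul_adicCompletion v hn
  rw [hbot, AddSubgroup.card_bot, one_mul, hO] at hcard
  rw [AddSubgroup.index]
  exact hcard

/-- **Every point outside `nE(K_v)` generates `E(K_v)` modulo `n`** when `E(K_v)[n] = 0` and `#(𝒪_v/n𝒪_v) = 2`: the subgroup
`nE(K_v)` has index `2`, so `P` and `P₀` lie in the same coset unless `P ∈ nE(K_v)`; either way `P = a•P₀ + n•R` (`a ∈ {0, −1}`).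
[cite: MilneADT2006, I Lemma 3.3] -/
theorem forall_exists_eq_zsmul_add_nsmul_adicCompletion {n : ℕ} (hn : n ≠ 0)
    (hker : ∀ Q : (W.baseChange (v.adicCompletion K)).toAffine.Point, n • Q = 0 → Q = 0)
    (hO : Nat.card (v.adicCompletionIntegers K ⧸ Ideal.span {(n : v.adicCompletionIntegers K)}) = 2)
    {P₀ : (W.baseChange (v.adicCompletion K)).toAffine.Point}
    (hP₀ : ∀ Q : (W.baseChange (v.adicCompletion K)).toAffine.Point, P₀ ≠ n • Q)
    (P : (W.baseChange (v.adicCompletion K)).toAffine.Point) :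
    ∃ a : ℤ, ∃ R : (W.baseChange (v.adicCompletion K)).toAffine.Point, P = a • P₀ + n • R := by
  have hidx := index_range_nsmul_adicCompletion_eq_two W v hn hker hO
  have hP₀H : P₀ ∉ (nsmulAddMonoidHom n : (W.baseChange (v.adicCompletion K)).toAffine.Point →+ _).range := by
    rintro ⟨Q, hQ⟩
    exact hP₀ Q (by rw [← hQ, nsmulAddMonoidHom_apply])
  by_cases hP : P ∈ (nsmulAddMonoidHom n : (W.baseChange (v.adicCompletion K)).toAffine.Point →+ _).range
  · obtain ⟨R, hR⟩ := hP
    exact ⟨0, R, by rw [zero_smul, zero_add, ← hR, nsmulAddMonoidHom_apply]⟩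
  · obtain ⟨R, hR⟩ : P + P₀ ∈ (nsmulAddMonoidHom n : (W.baseChange (v.adicCompletion K)).toAffine.Point →+ _).range :=
      (AddSubgroup.add_mem_iff_of_index_two hidx).2 (iff_of_false hP hP₀H)
    rw [nsmulAddMonoidHom_apply] at hR
    refine ⟨-1, R, ?_⟩
    rw [neg_one_zsmul, hR]
    abel

/-! ## §2 Transport to the `Γ_{K_v}`-fixed local points `localLayerPointsOfEmb κ ι W 0` -/

omit [W.IsElliptic] in
/-- The image of a point of `E(K_v)` in the tree's local points `E(K̄_v)` is `Γ_{K_v}`-fixed, i.e. lies in the layer-`0` local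
points of any `ℤ_p`-tower (`smul_toGeomPoints`, `mem_localLayerPointsOfEmb_zero_iff`). [cite: SilvermanAEC2009, VIII.§1] -/
theorem symm_toGeomPoints_mem_localLayerPointsOfEmb_zero {p : ℕ} [Fact p.Prime] (κ : ZpExtension K p)
    (ι : AlgebraicClosure K →ₐ[K] AlgebraicClosure (v.adicCompletion K))
    (Q : (W.baseChange (v.adicCompletion K)).toAffine.Point) :
    (localPointsEquivBaseChange W (v.adicCompletion K)).symm (toGeomPoints (W.baseChange (v.adicCompletion K)) Q) ∈
      localLayerPointsOfEmb κ ι W 0 := by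
  rw [mem_localLayerPointsOfEmb_zero_iff]
  intro τ
  apply (localPointsEquivBaseChange W (v.adicCompletion K)).injective
  rw [localPointsEquivBaseChange_smul, AddEquiv.apply_symm_apply, smul_toGeomPoints]

omit [W.IsElliptic] in
/-- A `Γ_{K_v}`-fixed point of `E(K̄_v)` (a layer-`0` local point) comes from `E(K_v)` (Galois descent
`exists_toGeomPoints_eq_of_forall_smul_eq`; `K_v` is perfect). [cite: SilvermanAEC2009, VIII.§1] -/
theorem exists_eq_symm_toGeomPoints_of_mem_localLayerPointsOfEmb_zero {p : ℕ} [Fact p.Prime] (κ : ZpExtension K p)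
    (ι : AlgebraicClosure K →ₐ[K] AlgebraicClosure (v.adicCompletion K))
    {b : localPoints W (v.adicCompletion K)} (hb : b ∈ localLayerPointsOfEmb κ ι W 0) :
    ∃ Q : (W.baseChange (v.adicCompletion K)).toAffine.Point,
      b = (localPointsEquivBaseChange W (v.adicCompletion K)).symm (toGeomPoints (W.baseChange (v.adicCompletion K)) Q) := by
  haveI : PerfectField (v.adicCompletion K) := by
    haveI : CharZero (v.adicCompletion K) := charZero_of_injective_algebraMap (algebraMap K _).injective
    infer_instance
  have hbfix : ∀ σ : Field.absoluteGaloisGroup (v.adicCompletion K),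
      σ • localPointsEquivBaseChange W (v.adicCompletion K) b = localPointsEquivBaseChange W (v.adicCompletion K) b :=
    fun σ ↦ by rw [← localPointsEquivBaseChange_smul, (mem_localLayerPointsOfEmb_zero_iff κ ι W b).1 hb σ]
  obtain ⟨Q₀, hQ₀⟩ :=
    WeierstrassCurve.exists_toGeomPoints_eq_of_forall_smul_eq (W.baseChange (v.adicCompletion K)) hbfix
  exact ⟨Q₀, by rw [hQ₀, AddEquiv.symm_apply_apply]⟩

omit [W.IsElliptic] in
/-- **Transport of "every non-multiple generates modulo `n`" from `E(K_v)` to the layer-`0` local points**: if every point of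
`E(K_v)` outside `nE(K_v)` generates `E(K_v)` modulo `n`, then every `d₀ ∈ E(K̄_v)^{Γ_{K_v}}` which is not `n`-divisible among the
fixed points generates them modulo `n`: `P = a•d₀ + n•R` with `R` fixed. [cite: SilvermanAEC2009, VIII.§1]
[cite: MilneADT2006, I Lemma 3.3] -/
theorem forall_exists_eq_zsmul_add_nsmul_localLayerPointsOfEmb_zero {p : ℕ} [Fact p.Prime] (κ : ZpExtension K p)
    (ι : AlgebraicClosure K →ₐ[K] AlgebraicClosure (v.adicCompletion K)) {n : ℕ}
    (h : ∀ P₀ : (W.baseChange (v.adicCompletion K)).toAffine.Point,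
      (∀ Q : (W.baseChange (v.adicCompletion K)).toAffine.Point, P₀ ≠ n • Q) →
      ∀ P : (W.baseChange (v.adicCompletion K)).toAffine.Point,
        ∃ a : ℤ, ∃ R : (W.baseChange (v.adicCompletion K)).toAffine.Point, P = a • P₀ + n • R)
    {d₀ : localPoints W (v.adicCompletion K)} (hd₀ : d₀ ∈ localLayerPointsOfEmb κ ι W 0)
    (hnd : ∀ b ∈ localLayerPointsOfEmb κ ι W 0, d₀ ≠ n • b) :
    ∀ P ∈ localLayerPointsOfEmb κ ι W 0,
      ∃ a : ℤ, ∃ R ∈ localLayerPointsOfEmb κ ι W 0, P = a • d₀ + n • R := by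
  intro P hP
  obtain ⟨D₀, hD₀⟩ := exists_eq_symm_toGeomPoints_of_mem_localLayerPointsOfEmb_zero W v κ ι hd₀
  obtain ⟨P₁, hP₁⟩ := exists_eq_symm_toGeomPoints_of_mem_localLayerPointsOfEmb_zero W v κ ι hP
  have hD₀' : ∀ Q : (W.baseChange (v.adicCompletion K)).toAffine.Point, D₀ ≠ n • Q := by
    intro Q hQ
    refine hnd _ (symm_toGeomPoints_mem_localLayerPointsOfEmb_zero W v κ ι Q) ?_
    rw [hD₀, hQ, map_nsmul, map_nsmul]
  obtain ⟨a, R₁, hR₁⟩ := h D₀ hD₀' P₁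
  refine ⟨a, (localPointsEquivBaseChange W (v.adicCompletion K)).symm
      (toGeomPoints (W.baseChange (v.adicCompletion K)) R₁),
    symm_toGeomPoints_mem_localLayerPointsOfEmb_zero W v κ ι R₁, ?_⟩
  rw [hP₁, hR₁, map_add, map_add, map_zsmul, map_zsmul, map_nsmul, map_nsmul, ← hD₀]

end General

/-! ## §3 `K = ℚ`, `n = 2`, `v ∋ 2`, good supersingular `2`: (GEN₀) ⟺ `d₀ ∉ 2E(ℚ_v)` -/

section Two

/-- **Every point of `E(ℚ_v)` outside `2E(ℚ_v)` generates `E(ℚ_v)` modulo `2`** for a globally minimal `W/ℚ` with good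
supersingular reduction at `2` (`GoodSS W 2`): `E(ℚ_v)[2] = 0` (`SSFlatEC.two_nsmul_eq_zero_padic_of_goodSS_two`) and
`#(ℤ_v/2ℤ_v) = 2`, so `[E(ℚ_v) : 2E(ℚ_v)] = 2` by Milne I Lemma 3.3. [cite: MilneADT2006, I Lemma 3.3]
[cite: Sprung2012, Lemma 2.3 (p. 1487)] -/
theorem forall_exists_eq_zsmul_add_two_nsmul_adicCompletion (W : WeierstrassCurve ℚ) [W.IsElliptic] [W.IsGloballyMinimal]
    (hss : Rank1Residual.GoodSS W 2) (v : HeightOneSpectrum (𝓞 ℚ)) (hv : (2 : 𝓞 ℚ) ∈ v.asIdeal)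
    {P₀ : (W.baseChange (v.adicCompletion ℚ)).toAffine.Point}
    (hP₀ : ∀ Q : (W.baseChange (v.adicCompletion ℚ)).toAffine.Point, P₀ ≠ 2 • Q)
    (P : (W.baseChange (v.adicCompletion ℚ)).toAffine.Point) :
    ∃ a : ℤ, ∃ R : (W.baseChange (v.adicCompletion ℚ)).toAffine.Point, P = a • P₀ + 2 • R := by
  have hv' : ((2 : ℕ) : 𝓞 ℚ) ∈ v.asIdeal := by exact_mod_cast hv
  have hker : ∀ Q : (W.baseChange (v.adicCompletion ℚ)).toAffine.Point, 2 • Q = 0 → Q = 0 :=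
    (W.forall_nsmul_eq_zero_adicCompletion_iff_padic (p := 2) hv' 2).mpr
      (SSFlatEC.two_nsmul_eq_zero_padic_of_goodSS_two W hss)
  have hO := WeierstrassCurve.natCard_adicCompletionIntegers_quot_span_prime (p := 2) (v := v) hv'
  exact forall_exists_eq_zsmul_add_nsmul_adicCompletion W v two_ne_zero hker hO hP₀ P

/-- **(GEN₀) ⟸ non-divisibility**: for a globally minimal `W/ℚ` with `GoodSS W 2`, any `ℤ₂`-extension `κ`, the place `v ∋ 2` and
any embedding `ι`, a layer-`0` local point `d₀ ∈ E(ℚ_v)` which is not of the form `2 • b`, `b ∈ E(ℚ_v)`, generates `E(ℚ_v)` modulo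
`2`: `E(ℚ_v) ⊆ ℤd₀ + 2E(ℚ_v)` — the fourth clause of the plus Honda system HONDA⁺@2 for `d 0 := d₀`.
[cite: MilneADT2006, I Lemma 3.3] [cite: Kobayashi2003, §8.4 (Prop. 8.11)] [cite: Sprung2012, Lemma 2.3 (p. 1487)] -/
theorem plusGenZero_two_of_ne_two_nsmul (W : WeierstrassCurve ℚ) [W.IsElliptic] [W.IsGloballyMinimal]
    (hss : Rank1Residual.GoodSS W 2) (κ : ZpExtension ℚ 2) (v : HeightOneSpectrum (𝓞 ℚ)) (hv : (2 : 𝓞 ℚ) ∈ v.asIdeal)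
    (ι : AlgebraicClosure ℚ →ₐ[ℚ] AlgebraicClosure (v.adicCompletion ℚ))
    {d₀ : localPoints W (v.adicCompletion ℚ)} (hd₀ : d₀ ∈ localLayerPointsOfEmb κ ι W 0)
    (hnd : ∀ b ∈ localLayerPointsOfEmb κ ι W 0, d₀ ≠ 2 • b) :
    ∀ P ∈ localLayerPointsOfEmb κ ι W 0, ∃ a : ℤ, ∃ R ∈ localLayerPointsOfEmb κ ι W 0, P = a • d₀ + 2 • R :=
  forall_exists_eq_zsmul_add_nsmul_localLayerPointsOfEmb_zero W v κ ι
    (fun _ hP₀ P ↦ forall_exists_eq_zsmul_add_two_nsmul_adicCompletion W hss v hv hP₀ P) hd₀ hnd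

/-- **(GEN₀) ⟹ non-divisibility, for EVERY elliptic `W/ℚ`**: if `d₀` generates the layer-`0` local points `E(ℚ_v)` modulo `2`,
then `d₀ ≠ 2 • b` for all `b ∈ E(ℚ_v)` — otherwise `E(ℚ_v) = 2E(ℚ_v)`, contradicting LEV0@2
(`exists_mem_localLayerPointsOfEmb_zero_ne_nsmul`, Milne I Lemma 3.3 with `#(ℤ_v/2) = 2 ≠ 1`). [cite: MilneADT2006, I Lemma 3.3] -/
theorem ne_two_nsmul_of_plusGenZero (W : WeierstrassCurve ℚ) [W.IsElliptic]
    (κ : ZpExtension ℚ 2) (v : HeightOneSpectrum (𝓞 ℚ)) (hv : (2 : 𝓞 ℚ) ∈ v.asIdeal)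
    (ι : AlgebraicClosure ℚ →ₐ[ℚ] AlgebraicClosure (v.adicCompletion ℚ))
    {d₀ : localPoints W (v.adicCompletion ℚ)}
    (hgen0 : ∀ P ∈ localLayerPointsOfEmb κ ι W 0, ∃ a : ℤ, ∃ R ∈ localLayerPointsOfEmb κ ι W 0, P = a • d₀ + 2 • R) :
    ∀ b ∈ localLayerPointsOfEmb κ ι W 0, d₀ ≠ 2 • b := by
  have hO : Nat.card (v.adicCompletionIntegers ℚ ⧸
      Ideal.span {((2 : ℕ) : v.adicCompletionIntegers ℚ)}) ≠ 1 := by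
    rw [WeierstrassCurve.natCard_adicCompletionIntegers_quot_span_prime (p := 2) (v := v) (by exact_mod_cast hv)]
    norm_num
  obtain ⟨m₀, hm₀, hne⟩ := exists_mem_localLayerPointsOfEmb_zero_ne_nsmul W v κ ι
    (exists_point_ne_nsmul_adicCompletion W v two_ne_zero hO)
  intro b hb hdb
  obtain ⟨a, R, hR, hm⟩ := hgen0 m₀ hm₀
  refine hne (a • b + R) (add_mem (AddSubgroup.zsmul_mem _ hb a) hR) ?_
  rw [hm, hdb, smul_add, smul_comm a (2 : ℕ) b]

/-! ## §4 The package glue: HONDA⁺@2 with (GEN₀) replaced by non-divisibility ⟹ HONDA⁺@2 -/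

/-- **A plus Honda system at `v ∋ 2` whose bottom point is merely NOT `2`-divisible in `E(ℚ_v)` is a plus Honda system** (clause
(GEN₀) recovered by `plusGenZero_two_of_ne_two_nsmul`), for one globally minimal `W` with `GoodSS W 2`, one `ℤ₂`-extension `κ` and
the place `v`; binder order and clause texts as in `SignedEC.plusCyclic_of_honda` / the `hHONDA` hypothesis of
`stub_plusCyclicLayersTwo_of_honda`. [cite: Kobayashi2003, §8.4 (Lemma 8.9, Prop. 8.11)] [cite: Sprung2012, Thm. 2.2 (2′), Lemma 2.3] -/
theorem hondaSystem_two_of_nonDiv (W : WeierstrassCurve ℚ) [W.IsElliptic] [W.IsGloballyMinimal]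
    (hss : Rank1Residual.GoodSS W 2) (κ : ZpExtension ℚ 2) (v : HeightOneSpectrum (𝓞 ℚ)) (hv : (2 : 𝓞 ℚ) ∈ v.asIdeal)
    (h : ∃ d : ℕ → localPoints W (v.adicCompletion ℚ),
      (∀ m, d m ∈ localLayerPointsOfEmb κ (closureEmb (K := ℚ) (v.adicCompletion ℚ)) W m) ∧
      (∀ m, localTraceOfEmb κ (closureEmb (K := ℚ) (v.adicCompletion ℚ)) W (m + 1) (m + 2) (d (m + 2)) = -d m) ∧
      (∀ m : ℕ, 1 ≤ m → ∀ P ∈ localLayerPointsOfEmb κ (closureEmb (K := ℚ) (v.adicCompletion ℚ)) W m,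
        ∃ B ∈ AddSubgroup.closure (Set.range fun σ : Field.absoluteGaloisGroup (v.adicCompletion ℚ) ↦ σ • d m),
          ∃ P' ∈ localLayerPointsOfEmb κ (closureEmb (K := ℚ) (v.adicCompletion ℚ)) W (m - 1),
          ∃ R ∈ localLayerPointsOfEmb κ (closureEmb (K := ℚ) (v.adicCompletion ℚ)) W m, P = B + P' + 2 • R) ∧
      (∀ b ∈ localLayerPointsOfEmb κ (closureEmb (K := ℚ) (v.adicCompletion ℚ)) W 0, d 0 ≠ 2 • b)) :
    ∃ d : ℕ → localPoints W (v.adicCompletion ℚ),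
      (∀ m, d m ∈ localLayerPointsOfEmb κ (closureEmb (K := ℚ) (v.adicCompletion ℚ)) W m) ∧
      (∀ m, localTraceOfEmb κ (closureEmb (K := ℚ) (v.adicCompletion ℚ)) W (m + 1) (m + 2) (d (m + 2)) = -d m) ∧
      (∀ m : ℕ, 1 ≤ m → ∀ P ∈ localLayerPointsOfEmb κ (closureEmb (K := ℚ) (v.adicCompletion ℚ)) W m,
        ∃ B ∈ AddSubgroup.closure (Set.range fun σ : Field.absoluteGaloisGroup (v.adicCompletion ℚ) ↦ σ • d m),
          ∃ P' ∈ localLayerPointsOfEmb κ (closureEmb (K := ℚ) (v.adicCompletion ℚ)) W (m - 1),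
          ∃ R ∈ localLayerPointsOfEmb κ (closureEmb (K := ℚ) (v.adicCompletion ℚ)) W m, P = B + P' + 2 • R) ∧
      (∀ P ∈ localLayerPointsOfEmb κ (closureEmb (K := ℚ) (v.adicCompletion ℚ)) W 0,
        ∃ a : ℤ, ∃ R ∈ localLayerPointsOfEmb κ (closureEmb (K := ℚ) (v.adicCompletion ℚ)) W 0, P = a • d 0 + 2 • R) := by
  obtain ⟨d, hd, htr, hgen, hnd⟩ := h
  exact ⟨d, hd, htr, hgen, plusGenZero_two_of_ne_two_nsmul W hss κ v hv _ (hd 0) hnd⟩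

/-- **Over the sub-row `¬CM, r_an = 0, GoodSS 2, a₂ = 0`: the plus Honda system with non-divisible bottom point at every `v ∋ 2`
implies HONDA⁺@2 VERBATIM** (the conclusion is literally the hypothesis `hHONDA` of `stub_plusCyclicLayersTwo_of_honda`,
`stub_plusLocKummerTwo_of_honda`, `stub_plusLocalInjTwo_of_honda`) — so the constructor of the Honda points owes, at level `0`,
only `d 0 ∉ 2E(ℚ_v)`. [cite: Kobayashi2003, §8.4 (Lemma 8.9, Prop. 8.11, Prop. 8.12)] [cite: Sprung2012, Thm. 2.2 (2′), Lemma 2.3] -/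
theorem plusHondaSystemTwo_of_nonDiv
    (h : ∀ (W : WeierstrassCurve ℚ) [W.IsElliptic] [W.IsGloballyMinimal],
      ¬ W.HasCM → W.analyticRank = 0 → Rank1Residual.GoodSS W 2 → W.frobeniusTrace 2 = 0 →
      ∀ (κ : ZpExtension ℚ 2), κ.IsCyclotomic →
      ∀ (v : HeightOneSpectrum (𝓞 ℚ)), (2 : 𝓞 ℚ) ∈ v.asIdeal →
      ∃ d : ℕ → localPoints W (v.adicCompletion ℚ),
        (∀ m, d m ∈ localLayerPointsOfEmb κ (closureEmb (K := ℚ) (v.adicCompletion ℚ)) W m) ∧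
        (∀ m, localTraceOfEmb κ (closureEmb (K := ℚ) (v.adicCompletion ℚ)) W (m + 1) (m + 2) (d (m + 2)) = -d m) ∧
        (∀ m : ℕ, 1 ≤ m → ∀ P ∈ localLayerPointsOfEmb κ (closureEmb (K := ℚ) (v.adicCompletion ℚ)) W m,
          ∃ B ∈ AddSubgroup.closure (Set.range fun σ : Field.absoluteGaloisGroup (v.adicCompletion ℚ) ↦ σ • d m),
            ∃ P' ∈ localLayerPointsOfEmb κ (closureEmb (K := ℚ) (v.adicCompletion ℚ)) W (m - 1),
            ∃ R ∈ localLayerPointsOfEmb κ (closureEmb (K := ℚ) (v.adicCompletion ℚ)) W m, P = B + P' + 2 • R) ∧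
        (∀ b ∈ localLayerPointsOfEmb κ (closureEmb (K := ℚ) (v.adicCompletion ℚ)) W 0, d 0 ≠ 2 • b)) :
    ∀ (W : WeierstrassCurve ℚ) [W.IsElliptic] [W.IsGloballyMinimal],
      ¬ W.HasCM → W.analyticRank = 0 → Rank1Residual.GoodSS W 2 → W.frobeniusTrace 2 = 0 →
      ∀ (κ : ZpExtension ℚ 2), κ.IsCyclotomic →
      ∀ (v : HeightOneSpectrum (𝓞 ℚ)), (2 : 𝓞 ℚ) ∈ v.asIdeal →
      ∃ d : ℕ → localPoints W (v.adicCompletion ℚ),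
        (∀ m, d m ∈ localLayerPointsOfEmb κ (closureEmb (K := ℚ) (v.adicCompletion ℚ)) W m) ∧
        (∀ m, localTraceOfEmb κ (closureEmb (K := ℚ) (v.adicCompletion ℚ)) W (m + 1) (m + 2) (d (m + 2)) = -d m) ∧
        (∀ m : ℕ, 1 ≤ m → ∀ P ∈ localLayerPointsOfEmb κ (closureEmb (K := ℚ) (v.adicCompletion ℚ)) W m,
          ∃ B ∈ AddSubgroup.closure (Set.range fun σ : Field.absoluteGaloisGroup (v.adicCompletion ℚ) ↦ σ • d m),
            ∃ P' ∈ localLayerPointsOfEmb κ (closureEmb (K := ℚ) (v.adicCompletion ℚ)) W (m - 1),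
            ∃ R ∈ localLayerPointsOfEmb κ (closureEmb (K := ℚ) (v.adicCompletion ℚ)) W m, P = B + P' + 2 • R) ∧
        (∀ P ∈ localLayerPointsOfEmb κ (closureEmb (K := ℚ) (v.adicCompletion ℚ)) W 0,
          ∃ a : ℤ, ∃ R ∈ localLayerPointsOfEmb κ (closureEmb (K := ℚ) (v.adicCompletion ℚ)) W 0, P = a • d 0 + 2 • R) :=
  fun W _ _ hcm hr hss ha κ hκ v hv ↦ hondaSystem_two_of_nonDiv W hss κ v hv (h W hcm hr hss ha κ hκ v hv)

end Two

end Summit.BirchSwinnertonDyer.BirchSwinnertonDyer.Theorems.SignedEC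

end
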